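import Mathlib
import Literature.Barriers.ValiantsHypothesis.AlgebraicNaturalProofs
import Literature.Computability.AlgebraicComplexity.RazUniversalCircuits
import Literature.Computability.AlgebraicComplexity.ValiantClasses

/-!
# Crux `BarrierLever.DefinableEquations` (stmt-ValiantsHypothesis-8745), line `registered`
# (raz-tableau) — definitions

The line factors the crux (ONE level `a` of boolean-sum equations against `SmallCircuits ℂ n b`
for every `b`, `N = C(2n,n)` coefficient variables) through the image of Raz's polynomial map
`Γ` (tree: `RazUniversal.uCoeff`) on the top (degree-`n`) monomials, and seeks the equation among
short combinations of TABLEAU CONTRACTIONS `F_τ = ⟨∏_columns det, t(f)^{⊗ D}⟩`.  This file holds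
ALL definitions of the development (the stub theorem files
`BarrierLeverDefinableEquations*.lean` are definition-free):

* §0 the objects: `topMonomials`, `topIncl`, `expOf`, `expTop`, `symWeight`, `razSlots`,
  `razPoint`, `TabDatum` (+ `sign`, `poly`, `Bounded`), `combPoly`, `ShortComb`;
* §1 the Boolean block of the Valiant-criterion witness: one-hot positions `BPos D n`
  (block, tensor position, value), `oneHot`, and the Boolean point `boolPt` of `boolSum`;
* §2 the gadget specifications the stubs prove (`signSpec`, `weightSpec`, `selSpec`) and the
  witness specifications they assemble to (`datumWitnessSpec`, `combWitnessSpec`); all size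
  bounds are generous polynomials in `B + n + 2` (times `C(2n,n)` where a sum over top monomials
  occurs), `B` a common bound on the datum (`TabDatum.Bounded`).

Sources: R. Raz, Theory Comput. 6 (2010), Prop. 3.3; P. Bürgisser, *Completeness and Reduction
in Algebraic Complexity Theory* (2000), Prop. 2.20 (Valiant's criterion); Bürgisser–Clausen–
Shokrollahi 1997, Prop. (21.15) (recognisers); J. M. Landsberg, *Geometry and Complexity Theory*
(2017), §8–9 (highest-weight vectors via Young tableaux); Forbes–Shpilka–Volk 2018, Def. 1.
-/

-- Sub = Summit single-conjunct layout: the duplicated namespace component is mandated by the tree.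
set_option linter.dupNamespace false

noncomputable section

namespace Summit.ValiantsHypothesis.ValiantsHypothesis.Theorems.BarrierLeverDefinableEquations

open MvPolynomial
open Literature.Computability.AlgebraicComplexity Literature.Barriers.ValiantsHypothesis
open scoped BigOperators

/-! ## §0 Top monomials, Raz points, tableau contractions -/

/-- Exponents of degree EXACTLY `n` in `n` variables: the coordinates of `Sym^n ℂ^n` (the top
homogeneous component), a subset of the crux's `degLEMonomials n`. -/
def topMonomials (n : ℕ) : Set (Fin n →₀ ℕ) := {m | m.degree = n}

/-- Top monomials have degree `≤ n`. -/
theorem topMonomials_subset (n : ℕ) : topMonomials n ⊆ degLEMonomials n :=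
  fun _ hm => le_of_eq hm

/-- The inclusion of variable sets `topMonomials n ↪ degLEMonomials n`. -/
def topIncl (n : ℕ) : topMonomials n → degLEMonomials n := Set.inclusion (topMonomials_subset n)

/-- `topIncl` is injective (registered sub-goal of the line: the composition `DefinableEquations_of`
uses it to transport `combPoly τ c ≠ 0` along `rename (topIncl n)`). [folklore] -/
theorem topIncl_injective : ∀ n : ℕ, Function.Injective (topIncl n) :=
  fun n => Set.inclusion_injective (topMonomials_subset n)

/-- The exponent vector of a block of `n` tensor indices `v : Fin n → Fin n` (symmetric-tensor slot
`t_v` ↦ monomial `∏_l x_{v l}`). -/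
def expOf {n : ℕ} (v : Fin n → Fin n) : Fin n →₀ ℕ := ∑ l : Fin n, Finsupp.single (v l) 1

/-- `expOf v` has degree `n`. -/
theorem degree_expOf {n : ℕ} (v : Fin n → Fin n) : (expOf v).degree = n := by
  simp [expOf, map_sum]

/-- `expOf v` as a top monomial. -/
def expTop {n : ℕ} (v : Fin n → Fin n) : topMonomials n := ⟨expOf v, degree_expOf v⟩

/-- The symmetric-tensor weight `∏_l e_l!` (`t_e = (∏_l e_l! / n!) c_e`; the global `1/n!` per
tensor factor is dropped). -/
def symWeight {n : ℕ} (e : Fin n →₀ ℕ) : ℕ := ∏ l : Fin n, (e l).factorial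

/-- Raz's slot count for circuits of size `n ^ b` and degree `n` (`N ≥ 4 s (r+1)²` in
`RazUniversal.exists_eval_uCoeff_eq_coeff`). -/
def razSlots (n b : ℕ) : ℕ := 4 * n ^ b * (n + 1) ^ 2

/-- The point `Γ(y)` of Raz's polynomial map on the top monomials: coordinate `e ↦ uCoeff_e (y)`. -/
def razPoint (n b : ℕ) (y : RazUniversal.Lab (Fin n) n (razSlots n b) → ℂ) : topMonomials n → ℂ :=
  fun e => eval y (RazUniversal.uCoeff ℂ (Fin n) n (razSlots n b) (e : Fin n →₀ ℕ))

/-- A TABLEAU-CONTRACTION DATUM on `D` blocks of `n` tensor positions: `L` columns, column `j` of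
`size j` rows, the cell of row-slot `a` a set of positions (block, position) with, for every row
`b`, a template of prescribed tensor indices.  (Cells = single positions with template
"index = row" give the classical highest-weight vectors `e_T`; half-block cells give flattening
minors.) -/
structure TabDatum (n : ℕ) where
  /-- number of copies of the form (degree of the contraction polynomial in the coefficients) -/
  D : ℕ
  /-- number of columns (determinant factors) -/
  L : ℕ
  /-- size of column `j` -/
  size : Fin L → ℕ
  /-- the cell of column `j`, row-slot `a`: a set of tensor positions -/
  cell : (j : Fin L) → Fin (size j) → Finset (Fin D × Fin n)
  /-- the template of column `j`, row `b`: prescribed indices on positions -/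
  tmpl : (j : Fin L) → Fin (size j) → Fin D × Fin n → Fin n

namespace TabDatum

variable {n : ℕ}

/-- The sign `ε_τ(i) = ∏_j det M_j(i)`, `M_j(i)_{a b} = [i agrees with template (j,b) on cell (j,a)]`. -/
def sign (τ : TabDatum n) (i : Fin τ.D × Fin n → Fin n) : ℤ :=
  ∏ j : Fin τ.L, Matrix.det (Matrix.of fun a b : Fin (τ.size j) =>
    if ∀ p ∈ τ.cell j a, i p = τ.tmpl j b p then (1 : ℤ) else 0)

/-- The tableau-contraction polynomial `F_τ = ∑_i ε_τ(i) ∏_{k < D} t_{i|block k}` in the top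
coefficient variables (`t_e = (∏_l e_l!) · c_e`). -/
def poly (τ : TabDatum n) : MvPolynomial (topMonomials n) ℂ :=
  ∑ i : Fin τ.D × Fin n → Fin n, (τ.sign i : ℂ) •
    ∏ k : Fin τ.D, ((symWeight (expOf fun l => i (k, l)) : ℂ) • X (expTop fun l => i (k, l)))

/-- Size bound on a datum: `D, L ≤ B` and all column sizes `≤ B`. [folklore] -/
def Bounded (B : ℕ) (τ : TabDatum n) : Prop :=
  τ.D ≤ B ∧ τ.L ≤ B ∧ ∀ j, τ.size j ≤ B

end TabDatum

/-- A (complex) linear combination of tableau contractions. -/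
def combPoly {n k : ℕ} (τ : Fin k → TabDatum n) (a : Fin k → ℂ) :
    MvPolynomial (topMonomials n) ℂ :=
  ∑ i : Fin k, a i • (τ i).poly

/-- Shortness: at most `B` data, each `B`-bounded (the coefficients are unrestricted complex
numbers: constants are free in the size measure `complexity`). [folklore] -/
def ShortComb (B : ℕ) {n k : ℕ} (τ : Fin k → TabDatum n) : Prop :=
  k ≤ B ∧ ∀ i, (τ i).Bounded B

/-! ## §1 The Boolean block of the witness (one-hot encoding of the tensor indices) -/

/-- Boolean positions of the one-hot encoding of an index function on `D` blocks of `n` tensor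
positions: `((block, position), value)`. -/
abbrev BPos (D n : ℕ) : Type := (Fin D × Fin n) × Fin n

/-- The one-hot graph of an index function `i`: position `((k, l), v)` is `true` iff `i (k, l) = v`. -/
def oneHot {D n : ℕ} (i : Fin D × Fin n → Fin n) : BPos D n → Bool :=
  fun v => decide (i v.1 = v.2)

/-- The Boolean point of `boolSum` at an assignment `u` of a Boolean block `β`: the polynomial
variables stay (`X`), the Boolean ones become `0/1`. -/
def boolPt {σ β : Type*} (u : β → Bool) : σ ⊕ β → MvPolynomial σ ℂ :=
  Sum.elim X fun v => if u v then 1 else 0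

/-! ## §2 Gadget and witness specifications (the registered stubs conclude these) -/

/-- **Sign gadget**: a polynomial on the Boolean block of `τ` (size and degree polynomial in
`B + n + 2`) whose value at the one-hot point of every index function `i` is the sign `ε_τ(i)`
(a specification proved by the stub `stub_signGadget`, not a cited fact). [folklore] -/
def signSpec (n : ℕ) (τ : TabDatum n) (B : ℕ) : Prop :=
  ∃ G : MvPolynomial (topMonomials n ⊕ BPos τ.D n) ℂ,
    complexity G ≤ (B + n + 2) ^ 12 ∧ G.totalDegree ≤ (B + n + 2) ^ 4 ∧
      ∀ i : Fin τ.D × Fin n → Fin n, aeval (boolPt (oneHot i)) G = C ((τ.sign i : ℂ))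

/-- **Weight gadgets**: for every block `k` a polynomial on the Boolean block whose value at the
one-hot point of `i` is the symmetric-tensor weight `∏_l e_l!` of the block `e = expOf (i (k, ·))`
(specification of stub `stub_weightGadget`). [folklore] -/
def weightSpec (n : ℕ) (τ : TabDatum n) (B : ℕ) : Prop :=
  ∃ G : Fin τ.D → MvPolynomial (topMonomials n ⊕ BPos τ.D n) ℂ, ∀ k : Fin τ.D,
    complexity (G k) ≤ (B + n + 2) ^ 4 ∧ (G k).totalDegree ≤ (B + n + 2) ^ 2 ∧
      ∀ i : Fin τ.D × Fin n → Fin n,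
        aeval (boolPt (oneHot i)) (G k) = C ((symWeight (expOf fun l => i (k, l)) : ℂ))

/-- **Selector gadgets**: for every block `k` a polynomial (in the coefficient variables and the
Boolean block) whose value at the one-hot point of `i` is the variable `X_{expOf (i (k, ·))}`
(specification of stub `stub_selGadget`). [folklore] -/
def selSpec (n : ℕ) (τ : TabDatum n) (B : ℕ) : Prop :=
  ∃ G : Fin τ.D → MvPolynomial (topMonomials n ⊕ BPos τ.D n) ℂ, ∀ k : Fin τ.D,
    complexity (G k) ≤ (B + n + 2) ^ 4 * Nat.choose (2 * n) n ∧
      (G k).totalDegree ≤ (B + n + 2) ^ 3 ∧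
        ∀ i : Fin τ.D × Fin n → Fin n, aeval (boolPt (oneHot i)) (G k) = X (expTop fun l => i (k, l))

/-- **Per-datum witness** (Valiant's criterion for one tableau contraction): `F_τ = boolSum H`
for an `H` on `τ.D · n · n` Boolean variables of size `≤ (B+n+2)^14 · C(2n,n)` and degree
`≤ (B+n+2)^6` (specification concluded by stub `stub_datumWitness`). [folklore] -/
def datumWitnessSpec (n : ℕ) (τ : TabDatum n) (B : ℕ) : Prop :=
  ∃ H : MvPolynomial (topMonomials n ⊕ Fin (τ.D * n * n)) ℂ,
    boolSum H = τ.poly ∧ complexity H ≤ (B + n + 2) ^ 14 * Nat.choose (2 * n) n ∧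
      H.totalDegree ≤ (B + n + 2) ^ 6

/-- **Combination witness**: the combination `combPoly τ c`, renamed into the crux's
`degLEMonomials n` variables, is `boolSum H` for an `H` on `B · n · n` Boolean variables of size
`≤ (B+n+2)^17 · C(2n,n)` and degree `≤ (B+n+2)^7` (specification concluded by stub `stub_combClosure`).
[folklore] -/
def combWitnessSpec (n k : ℕ) (τ : Fin k → TabDatum n) (c : Fin k → ℂ) (B : ℕ) : Prop :=
  ∃ H : MvPolynomial (degLEMonomials n ⊕ Fin (B * n * n)) ℂ,
    boolSum H = rename (topIncl n) (combPoly τ c) ∧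
      complexity H ≤ (B + n + 2) ^ 17 * Nat.choose (2 * n) n ∧ H.totalDegree ≤ (B + n + 2) ^ 7

end Summit.ValiantsHypothesis.ValiantsHypothesis.Theorems.BarrierLeverDefinableEquations

end
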